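import Summits.RiemannHypothesis.RiemannHypothesis.Theses.SpectralTrace
import Summits.RiemannHypothesis.RiemannHypothesis.Theorems.WindowTraceArch.Negative.UnitMass
import Summits.RiemannHypothesis.RiemannHypothesis.Theorems.WindowTraceArch.Negative.LocalWeylTools
import Summits.RiemannHypothesis.RiemannHypothesis.Theorems.WindowTraceArch.Negative.ComplexSpectrum
import Literature.NumberTheory.LFunctions.WeilCriterionProofs

/-!
# CANDIDATE THEOREMS FILE (crux-ideate, ideator 3, gen 2): complete proof of the crux via `power-method-projector`
(no Prop-valued helper defs; landable as `Theorems/SpectralIsHpSpectrumPowerMethod.lean` by a prover)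
for `SpectralIsHpSpectrum` (stmt-RiemannHypothesis-0195, route SpectralTrace).

Lever. Convolution powers `k^{⋆(n+1)}` of ONE peaked positive-definite Weil test
`k = ψ_τ ⋆ ψ̃_τ` (`ψ_τ(x) = φ(x) e^{-iτx} / ∫φ`, `φ` a real smooth bump) are again Weil tests, with
critical-line transform `a(t)^(n+1)` where `a(t) = |φ̂(t-τ)|² / (∫φ)² ∈ [0,1]` and `a(t) = 1 ↔ t = τ`.
So for EVERY real family `γ` reproducing `W` on all Weil tests,
`W(k^{⋆(n+1)}) = Σ_i a(γ_i)^(n+1)`, a sum of terms in `[0,1]` that DECREASE in `n` to the indicator of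
`γ_i = τ`; Tannery (dominator = the `n = 0` terms, summable because the hypothesis says so) gives
`W(k^{⋆(n+1)}) ↓ #{i | γ_i = τ}`. The limit is a functional of `W` alone, hence identical for the
zeros-with-multiplicity family under RH (`hasSum_weilMellin_zeros`, `eq_half_add_of_riemannHypothesis`;
RH itself from the hypothesis, Disproof §1 `riemannHypothesis_of_isTrace`), and the crux follows through
the disprover's reduction `spectralIsHpSpectrum_iff_rigidity_under_rh` (Disproof §2).
No local Weyl law, no temperedness, no measure / charFun, no dilation lemma: the test class's closure
under `weilConv` (in tree: `IsWeilTest.weilConv`, `weilMellin_weilConv_holds`) is the whole engine.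
-/

noncomputable section

open Complex Set MeasureTheory Filter Topology
open scoped Real

namespace Summit.RiemannHypothesis.RiemannHypothesis.Cruxes.SpectralIsHpSpectrum.PowerMethod

open Literature.NumberTheory.LFunctions
open Summit.RiemannHypothesis.RiemannHypothesis.Theses.SpectralTrace (SpectralIsHpSpectrum)
open Summit.RiemannHypothesis.RiemannHypothesis.Theorems.WindowTraceArch.Negative

/-- Convolution powers: `convPow k n = k^{⋆(n+1)}` (`convPow k 0 = k`). -/
def convPow (k : ℝ → ℂ) : ℕ → (ℝ → ℂ)
  | 0 => k
  | n + 1 => weilConv k (convPow k n)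

/-- **L1 — the power method (pure real analysis, no `W`).** For a summable family of reals in
`[0,1]`, the sums of `(n+1)`-st powers tend to the number of indices where the value is `1`
(Tannery `tendsto_tsum_of_dominated_convergence`, dominator = the terms themselves (`n = 0`);
the set `{i | a i = 1}` is finite because `a` is summable, so `ncard` is the honest count) — PROVED. -/
theorem tendsto_tsum_pow {ι : Type*} (a : ι → ℝ) (h0 : ∀ i, 0 ≤ a i) (h1 : ∀ i, a i ≤ 1)
    (hs : Summable a) :
    Tendsto (fun n : ℕ => ∑' i, a i ^ (n + 1)) atTop (𝓝 ({i | a i = 1}.ncard : ℝ)) := by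
  set S : Set ι := {i | a i = 1} with hS
  -- pointwise: `a i ^ (n+1) → 𝟙_S i`
  have hlim : ∀ i, Tendsto (fun n : ℕ => a i ^ (n + 1)) atTop (𝓝 (S.indicator (fun _ => (1 : ℝ)) i)) := by
    intro i
    by_cases hi : a i = 1
    · have hmem : i ∈ S := hi
      simp only [Set.indicator_of_mem hmem, hi, one_pow]
      exact tendsto_const_nhds
    · have hlt : a i < 1 := lt_of_le_of_ne (h1 i) hi
      rw [Set.indicator_of_notMem (show i ∉ S from hi)]
      exact (tendsto_pow_atTop_nhds_zero_of_lt_one (h0 i) hlt).comp (tendsto_add_atTop_nat 1)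
  -- Tannery, dominated by the `n = 0` terms
  have hT := tendsto_tsum_of_dominated_convergence (𝓕 := (atTop : Filter ℕ))
    (f := fun (n : ℕ) (i : ι) => a i ^ (n + 1)) (bound := a) hs hlim
    (Eventually.of_forall fun n i => by
      rw [Real.norm_eq_abs, abs_of_nonneg (pow_nonneg (h0 i) _)]
      exact pow_le_of_le_one (h0 i) (h1 i) (Nat.succ_ne_zero n))
  -- the limit is the honest count
  have hcount : ∑' i, S.indicator (fun _ => (1 : ℝ)) i = (S.ncard : ℝ) := by
    rw [← tsum_subtype S (fun _ => (1 : ℝ)), tsum_const, nsmul_eq_mul, mul_one, Nat.card_coe_set_eq]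
  rw [← hcount]
  exact hT

/-- **L2 — the peak test at `τ`.** A Weil test whose critical-line transform is real, valued in
`[0,1]`, and equal to `1` exactly at `t = τ`: `k = ψ ⋆ ψ̃` with `ψ(x) = φ(x)e^{-iτx}/∫φ`, `φ` a
`ContDiffBump` cast to `ℂ` (tree: `isWeilTest_modulate`, `weilMellin_modulate`,
`IsWeilTest.weilConv/.weilReflect`, `weilMellin_weilConv_weilReflect_half`); `a u ≤ 1` is
`|∫ φ e^{i(u-τ)x}| ≤ ∫ φ`, and strictness for `u ≠ τ` is `∫ φ(x) (1 - cos((u-τ)x - θ)) dx > 0`. -/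
theorem exists_peak_test (τ : ℝ) :
    ∃ k : ℝ → ℂ, IsWeilTest k ∧ ∃ a : ℝ → ℝ,
      (∀ u : ℝ, weilMellin k (1 / 2 + (u : ℂ) * I) = (a u : ℂ)) ∧
      (∀ u, 0 ≤ a u) ∧ (∀ u, a u ≤ 1) ∧ (∀ u, a u = 1 ↔ u = τ) := by
  -- the bump `b` (≡ 1 on [-1,1], supported in (-2,2)), cast to `ℂ`
  let b : ContDiffBump (0 : ℝ) := ⟨1, 2, one_pos, one_lt_two⟩
  set φ : ℝ → ℂ := fun t => ((b t : ℝ) : ℂ) with hφ_def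
  have hφ : IsWeilTest φ :=
    ⟨Complex.ofRealCLM.contDiff.comp b.contDiff, b.hasCompactSupport.comp_left Complex.ofReal_zero⟩
  set m : ℝ := ∫ t, b t with hm
  have hmpos : 0 < m := b.integral_pos
  -- `φ̂(1/2 + iv) = ∫ b(t) e^{ivt} dt`
  have hint_eq : ∀ v : ℝ, weilMellin φ (1 / 2 + (v : ℂ) * I) =
      ∫ t, ((b t : ℝ) : ℂ) * cexp (((v * t : ℝ) : ℂ) * I) := by
    intro v
    unfold weilMellin
    refine integral_congr_ae (Eventually.of_forall fun t => ?_)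
    have e : (1 / 2 + (v : ℂ) * I - 1 / 2) * (t : ℂ) = ((v * t : ℝ) : ℂ) * I := by push_cast; ring
    simp only [hφ_def]
    rw [e]
  -- (A) `|φ̂| ≤ m`
  have hA : ∀ v : ℝ, ‖weilMellin φ (1 / 2 + (v : ℂ) * I)‖ ≤ m := by
    intro v
    rw [hint_eq, hm]
    refine (norm_integral_le_integral_norm _).trans (le_of_eq ?_)
    refine integral_congr_ae (Eventually.of_forall fun t => ?_)
    simp only
    rw [norm_mul, Complex.norm_exp_ofReal_mul_I, mul_one, Complex.norm_real, Real.norm_eq_abs,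
      abs_of_nonneg b.nonneg]
  -- (B) `φ̂(1/2) = m`
  have hB : weilMellin φ (1 / 2) = (m : ℂ) := by
    have h0 := hint_eq 0
    simp only [Complex.ofReal_zero, zero_mul, add_zero, Complex.exp_zero, mul_one] at h0
    rw [h0, hm]
    exact integral_ofReal
  -- (C) strictness: `|φ̂(1/2 + iv)| < m` for `v ≠ 0`
  have hC : ∀ v : ℝ, v ≠ 0 → ‖weilMellin φ (1 / 2 + (v : ℂ) * I)‖ < m := by
    intro v hv
    set z := weilMellin φ (1 / 2 + (v : ℂ) * I) with hz
    set θ : ℝ := Complex.arg z with hθ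
    -- rotate `z` to the positive axis
    have hrot : cexp (-((θ : ℂ) * I)) * z = (‖z‖ : ℂ) := by
      have h := Complex.norm_mul_exp_arg_mul_I z
      rw [← hθ] at h
      calc cexp (-((θ : ℂ) * I)) * z
          = cexp (-((θ : ℂ) * I)) * ((‖z‖ : ℂ) * cexp ((θ : ℂ) * I)) := by rw [h]
        _ = (‖z‖ : ℂ) * (cexp (-((θ : ℂ) * I)) * cexp ((θ : ℂ) * I)) := by ring
        _ = (‖z‖ : ℂ) := by rw [← Complex.exp_add, neg_add_cancel, Complex.exp_zero, mul_one]
    have hF_int : Integrable fun t : ℝ => ((b t : ℝ) : ℂ) * cexp (((v * t - θ : ℝ) : ℂ) * I) :=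
      ((Complex.continuous_ofReal.comp b.continuous).mul (by fun_prop)).integrable_of_hasCompactSupport
        ((b.hasCompactSupport.comp_left Complex.ofReal_zero).mul_right)
    -- `‖z‖ = ∫ b(t) cos(vt - θ) dt`
    have hnorm_eq : ‖z‖ = ∫ t, b t * Real.cos (v * t - θ) := by
      have h1 : cexp (-((θ : ℂ) * I)) * z =
          ∫ t, ((b t : ℝ) : ℂ) * cexp (((v * t - θ : ℝ) : ℂ) * I) := by
        rw [hz, hint_eq, ← integral_const_mul]
        refine integral_congr_ae (Eventually.of_forall fun t => ?_)
        simp only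
        rw [mul_left_comm, ← Complex.exp_add]
        congr 2
        push_cast
        ring
      have h2 := congrArg Complex.re h1
      rw [hrot, Complex.ofReal_re] at h2
      rw [h2]
      have h3 := integral_re hF_int
      simp only [RCLike.re_to_complex] at h3
      rw [← h3]
      refine integral_congr_ae (Eventually.of_forall fun t => ?_)
      simp only
      rw [Complex.re_ofReal_mul, Complex.exp_ofReal_mul_I_re]
    -- the deficit integrand `F = b · (1 - cos(v· - θ)) ≥ 0`
    set F : ℝ → ℝ := fun t => b t * (1 - Real.cos (v * t - θ)) with hF
    have hFcont : Continuous F :=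
      b.continuous.mul (continuous_const.sub (Real.continuous_cos.comp (by fun_prop)))
    have hFsupp : HasCompactSupport F := b.hasCompactSupport.mul_right
    have hFnn : 0 ≤ F := fun t => mul_nonneg b.nonneg (sub_nonneg.2 (Real.cos_le_one _))
    -- a point where `F ≠ 0`
    obtain ⟨t₀, ht₀b, ht₀c⟩ : ∃ t₀ : ℝ, t₀ ∈ Metric.ball (0 : ℝ) 2 ∧ Real.cos (v * t₀ - θ) ≠ 1 := by
      by_cases hθ1 : Real.cos θ = 1
      · have hsin : Real.sin θ = 0 := by
          have hsq := Real.sin_sq_add_cos_sq θ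
          rw [hθ1, one_pow] at hsq
          have h' : Real.sin θ ^ 2 = 0 := by linarith
          exact pow_eq_zero_iff two_ne_zero |>.1 h'
        have hred : ∀ t, Real.cos (v * t - θ) = Real.cos (v * t) := by
          intro t
          rw [Real.cos_sub, hθ1, hsin]
          ring
        by_cases hsmall : |v| < 2 * π
        · refine ⟨1, by rw [Metric.mem_ball, Real.dist_eq]; norm_num, ?_⟩
          rw [hred, mul_one]
          intro h
          exact hv ((Real.cos_eq_one_iff_of_lt_of_lt (abs_lt.1 hsmall).1 (abs_lt.1 hsmall).2).1 h)
        · push Not at hsmall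
          refine ⟨π / v, ?_, ?_⟩
          · rw [Metric.mem_ball, Real.dist_eq, sub_zero, abs_div, abs_of_pos Real.pi_pos,
              div_lt_iff₀ (abs_pos.2 hv)]
            linarith [Real.pi_pos]
          · rw [hred, show v * (π / v) = π by field_simp, Real.cos_pi]
            norm_num
      · exact ⟨0, Metric.mem_ball_self two_pos, by simpa using hθ1⟩
    have hFt₀ : F t₀ ≠ 0 := by
      have hbne : b t₀ ≠ 0 := by
        have : t₀ ∈ Function.support (b : ℝ → ℝ) := by
          rw [b.support_eq]
          exact ht₀b
        exact this
      show b t₀ * (1 - Real.cos (v * t₀ - θ)) ≠ 0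
      exact mul_ne_zero hbne (sub_ne_zero.2 (Ne.symm ht₀c))
    have hpos : 0 < ∫ t, F t :=
      hFcont.integral_pos_of_hasCompactSupport_nonneg_nonzero hFsupp hFnn hFt₀
    -- `∫ F = m - ‖z‖`
    have hint2 : Integrable fun t : ℝ => b t * Real.cos (v * t - θ) :=
      (b.continuous.mul (by fun_prop)).integrable_of_hasCompactSupport b.hasCompactSupport.mul_right
    have hsplit : ∫ t, F t = m - ‖z‖ := by
      rw [hnorm_eq, hm, ← integral_sub b.integrable hint2]
      refine integral_congr_ae (Eventually.of_forall fun t => ?_)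
      simp only [hF]
      ring
    linarith
  -- assemble: modulate by `τ`, autocorrelate, normalise by `m²`
  set h : ℝ → ℂ := fun t => cexp (-((τ * t : ℝ) : ℂ) * I) * φ t with hh_def
  have hh : IsWeilTest h := isWeilTest_modulate hφ τ
  have hk0 : IsWeilTest (weilConv h (weilReflect h)) := hh.weilConv hh.weilReflect
  set k : ℝ → ℂ := fun t => (((m ^ 2)⁻¹ : ℝ) : ℂ) * weilConv h (weilReflect h) t with hk_def
  have hk : IsWeilTest k := ⟨contDiff_const.mul hk0.1, hk0.2.mul_left⟩
  have hW : ∀ u : ℝ, weilMellin h (1 / 2 + (u : ℂ) * I) =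
      weilMellin φ (1 / 2 + ((u - τ : ℝ) : ℂ) * I) := fun u => by
    rw [hh_def]
    exact weilMellin_modulate φ τ u
  refine ⟨k, hk, fun u => (m ^ 2)⁻¹ * ‖weilMellin φ (1 / 2 + ((u - τ : ℝ) : ℂ) * I)‖ ^ 2,
    ?_, ?_, ?_, ?_⟩
  · intro u
    have e1 : weilMellin k (1 / 2 + (u : ℂ) * I) =
        (((m ^ 2)⁻¹ : ℝ) : ℂ) * weilMellin (weilConv h (weilReflect h)) (1 / 2 + (u : ℂ) * I) := by
      simp only [weilMellin, hk_def, mul_assoc]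
      exact integral_const_mul _ _
    rw [e1, weilMellin_weilConv_weilReflect_half hh u, hW u]
    push_cast
    ring
  · intro u
    positivity
  · intro u
    dsimp only
    have h2 : ‖weilMellin φ (1 / 2 + ((u - τ : ℝ) : ℂ) * I)‖ ^ 2 ≤ m ^ 2 :=
      pow_le_pow_left₀ (norm_nonneg _) (hA (u - τ)) 2
    rw [inv_mul_le_iff₀ (by positivity), mul_one]
    exact h2
  · intro u
    dsimp only
    constructor
    · intro h1
      by_contra hne
      have hlt := hC (u - τ) (sub_ne_zero.2 hne)
      have h3 : ‖weilMellin φ (1 / 2 + ((u - τ : ℝ) : ℂ) * I)‖ ^ 2 < m ^ 2 :=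
        pow_lt_pow_left₀ hlt (norm_nonneg _) two_ne_zero
      rw [inv_mul_eq_one₀ (by positivity)] at h1
      linarith
    · intro h1
      subst h1
      simp only [sub_self, Complex.ofReal_zero, zero_mul, add_zero]
      rw [hB, Complex.norm_real, Real.norm_eq_abs, abs_of_pos hmpos]
      exact inv_mul_cancel₀ (by positivity)

/-- **L3 — powers are tests and their transforms are powers** (induction on the tree lemmas
`IsWeilTest.weilConv` and `weilMellin_weilConv_holds`) — PROVED. -/
theorem isWeilTest_convPow {k : ℝ → ℂ} (hk : IsWeilTest k) (n : ℕ) :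
    IsWeilTest (convPow k n) ∧
      ∀ s : ℂ, weilMellin (convPow k n) s = weilMellin k s ^ (n + 1) := by
  induction n with
  | zero => exact ⟨hk, fun s => by simp [convPow]⟩
  | succ n ih =>
    refine ⟨?_, fun s => ?_⟩
    · show IsWeilTest (weilConv k (convPow k n))
      exact hk.weilConv ih.1
    · show weilMellin (weilConv k (convPow k n)) s = _
      rw [weilMellin_weilConv_holds hk.1.continuous hk.2 ih.1.1.continuous ih.1.2 s, ih.2 s]
      ring

/-- **L4 — the multiplicity formula.** For ANY real family reproducing `W` and a peak test `k` as in
L2: `Re W(k^{⋆(n+1)}) → #{i | γ_i = τ}` (L3 turns the hypothesis at `k^{⋆(n+1)}` into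
`HasSum (i ↦ a(γ_i)^(n+1)) (W(k^{⋆(n+1)}))`, then L1). The limit does not mention `γ`. PROVED from L1 + L3. -/
theorem tendsto_weilFunctional_convPow {ι : Type*} {γ : ι → ℝ} (hγ : (∀ g : ℝ → ℂ, IsWeilTest g →
      HasSum (fun i => weilMellin g (1 / 2 + (γ i : ℂ) * I)) (weilFunctional g))) (τ : ℝ)
    {k : ℝ → ℂ} (hk : IsWeilTest k) {a : ℝ → ℝ}
    (hka : ∀ u : ℝ, weilMellin k (1 / 2 + (u : ℂ) * I) = (a u : ℂ))
    (h0 : ∀ u, 0 ≤ a u) (h1 : ∀ u, a u ≤ 1) (hpeak : ∀ u, a u = 1 ↔ u = τ) :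
    Tendsto (fun n : ℕ => (weilFunctional (convPow k n)).re) atTop
      (𝓝 ({i | γ i = τ}.ncard : ℝ)) := by
  -- the hypothesis at `k^{⋆(n+1)}`, read on the critical line through L3, is a REAL `HasSum`
  have hreal : ∀ n : ℕ, HasSum (fun i => a (γ i) ^ (n + 1)) (weilFunctional (convPow k n)).re := by
    intro n
    have h := hγ _ (isWeilTest_convPow hk n).1
    have h' : HasSum (fun i => (((a (γ i) ^ (n + 1) : ℝ)) : ℂ)) (weilFunctional (convPow k n)) := by
      convert h using 1
      ext i
      rw [(isWeilTest_convPow hk n).2, hka, Complex.ofReal_pow]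
    simpa only [Complex.reCLM_apply, Complex.ofReal_re] using h'.mapL Complex.reCLM
  -- the dominator: the `n = 0` instance
  have hsum : Summable (fun i => a (γ i)) := by
    simpa using (hreal 0).summable
  have hL1 := tendsto_tsum_pow (fun i => a (γ i)) (fun i => h0 _) (fun i => h1 _) hsum
  have hset : {i | a (γ i) = 1} = {i | γ i = τ} := by
    ext i
    exact hpeak (γ i)
  rw [hset] at hL1
  exact hL1.congr fun n => (hreal n).tsum_eq

/-- **L5 — zero-side bookkeeping.** Under RH the fibre over `τ` of the zeros-with-multiplicity
family of `hasSum_weilMellin_zeros` has `m(1/2 + iτ)` elements (`eq_half_add_of_riemannHypothesis`,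
`riemannZetaZeroOrder_pos_iff`, `riemannZetaZeroOrder_nonneg`) — PROVED. -/
theorem ncard_ordinates_fibre (hRH : _root_.RiemannHypothesis) (τ : ℝ) :
    (({p : (Σ ρ : ZetaZeros.riemannZetaNontrivialZeros,
        Fin (riemannZetaZeroOrder (ρ : ℂ)).toNat) | (p.1 : ℂ).im = τ}.ncard : ℕ) : ℤ) =
      riemannZetaZeroOrder (1 / 2 + τ * I) := by
  have hs1 : (1 / 2 : ℂ) + τ * I ≠ 1 := by
    intro h
    have := congrArg Complex.re h
    norm_num at this
  -- under RH an index `p` lies over `τ` iff its zero IS `1/2 + iτ`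
  have key : ∀ p : (Σ ρ : ZetaZeros.riemannZetaNontrivialZeros,
      Fin (riemannZetaZeroOrder (ρ : ℂ)).toNat), (p.1 : ℂ).im = τ ↔ (p.1 : ℂ) = 1 / 2 + τ * I := by
    intro p
    constructor
    · intro h
      rw [← eq_half_add_of_riemannHypothesis hRH p.1, h]
    · intro h
      rw [h]
      simp
  by_cases hζ : riemannZeta (1 / 2 + τ * I) = 0
  · -- `1/2 + iτ` is a non-trivial zero `ρ₀`: the fibre is `{ρ₀} × Fin m(ρ₀)`
    have hmem : (1 / 2 : ℂ) + τ * I ∈ ZetaZeros.riemannZetaNontrivialZeros :=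
      ZetaZeros.riemannZetaNontrivialZeros.mem_of_re_pos hζ (by simp)
    have hset : {p : (Σ ρ : ZetaZeros.riemannZetaNontrivialZeros,
        Fin (riemannZetaZeroOrder (ρ : ℂ)).toNat) | (p.1 : ℂ).im = τ} =
        Set.range (Sigma.mk (⟨1 / 2 + τ * I, hmem⟩ : ZetaZeros.riemannZetaNontrivialZeros)) := by
      ext p
      simp only [Set.mem_setOf_eq, Set.mem_range, key]
      constructor
      · intro h
        obtain ⟨ρ, c⟩ := p
        have hρ : ρ = ⟨1 / 2 + τ * I, hmem⟩ := Subtype.ext h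
        subst hρ
        exact ⟨c, rfl⟩
      · rintro ⟨c, rfl⟩
        rfl
    rw [hset, Set.ncard_range_of_injective sigma_mk_injective, Nat.card_eq_fintype_card,
      Fintype.card_fin]
    exact Int.toNat_of_nonneg (riemannZetaZeroOrder_nonneg hs1)
  · -- not a zero: empty fibre, order `0`
    have hset : {p : (Σ ρ : ZetaZeros.riemannZetaNontrivialZeros,
        Fin (riemannZetaZeroOrder (ρ : ℂ)).toNat) | (p.1 : ℂ).im = τ} = ∅ := by
      ext p
      simp only [Set.mem_setOf_eq, Set.mem_empty_iff_false, iff_false]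
      intro h
      apply hζ
      rw [← (key p).1 h]
      exact ZetaZeros.riemannZetaNontrivialZeros.zeta_eq_zero p.1.2
    rw [hset, Set.ncard_empty]
    have h0 := riemannZetaZeroOrder_nonneg hs1
    have h1 : ¬ 0 < riemannZetaZeroOrder (1 / 2 + τ * I) := fun h =>
      hζ ((riemannZetaZeroOrder_pos_iff hs1).1 h)
    push_cast
    omega

/-- The ordinate family is a trace family under RH (this is `Disproof.isTrace_ordinates_of_rh`,
re-proved here from the landed `ComplexSpectrum` lemmas so that this file does not import the
disprover's work file). -/
theorem isTrace_ordinates (hRH : _root_.RiemannHypothesis) :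
    ∀ g : ℝ → ℂ, IsWeilTest g →
      HasSum (fun p : (Σ ρ : ZetaZeros.riemannZetaNontrivialZeros,
        Fin (riemannZetaZeroOrder (ρ : ℂ)).toNat) => weilMellin g (1 / 2 + (((p.1 : ℂ).im : ℝ) : ℂ) * I))
        (weilFunctional g) :=
  fun _ hg => by simpa only [eq_half_add_of_riemannHypothesis hRH] using hasSum_weilMellin_zeros hg

/-- **Composition** into the disprover's reduced form of the crux
(`spectralIsHpSpectrum_iff_rigidity_under_rh`, Disproof.lean §2, kernel-checked there):
L2, then L4 twice (for `γ` and for the ordinate family), `tendsto_nhds_unique`, L5. -/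
theorem ordinate_count_of_isTrace (ι : Type) (γ : ι → ℝ) (hRH : _root_.RiemannHypothesis)
    (hγ : (∀ g : ℝ → ℂ, IsWeilTest g →
      HasSum (fun i => weilMellin g (1 / 2 + (γ i : ℂ) * I)) (weilFunctional g))) (τ : ℝ) :
    (({i : ι | γ i = τ}.ncard : ℕ) : ℤ) = riemannZetaZeroOrder (1 / 2 + τ * I) := by
  obtain ⟨k, hk, a, hka, h0, h1, hpeak⟩ := exists_peak_test τ
  have hlimγ := tendsto_weilFunctional_convPow hγ τ hk hka h0 h1 hpeak
  have hlimζ := tendsto_weilFunctional_convPow (isTrace_ordinates hRH) τ hk hka h0 h1 hpeak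
  have heq := tendsto_nhds_unique hlimγ hlimζ
  rw [← ncard_ordinates_fibre hRH τ]
  exact_mod_cast heq

/-- Cheapest falsifier (i) of the card, RUN: the engine — convolution closure and multiplicativity of
the transform — is two landed lemmas. -/
example {k : ℝ → ℂ} (hk : IsWeilTest k) (s : ℂ) :
    IsWeilTest (weilConv k k) ∧ weilMellin (weilConv k k) s = weilMellin k s ^ 2 :=
  ⟨hk.weilConv hk, by rw [weilMellin_weilConv_holds hk.1.continuous hk.2 hk.1.continuous hk.2 s, sq]⟩

/-- On the critical line the peak test's powers have transform `a^(n+1)` (L3 specialised; this is the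
form L4 consumes). -/
example {k : ℝ → ℂ} (hk : IsWeilTest k) {a : ℝ → ℝ}
    (hka : ∀ u : ℝ, weilMellin k (1 / 2 + (u : ℂ) * I) = (a u : ℂ)) (n : ℕ) (u : ℝ) :
    weilMellin (convPow k n) (1 / 2 + (u : ℂ) * I) = ((a u ^ (n + 1) : ℝ) : ℂ) := by
  rw [(isWeilTest_convPow hk n).2, hka]
  push_cast
  rfl

/-! ## Reduction to the ordinate count — VERBATIM from the disprover's work file
`Cruxes/SpectralIsHpSpectrum/Disproof.lean` §0–§2 (refuter-cdisprove-stmt-RiemannHypothesis-0195-0,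
2026-08-16), copied here only because that file is not a built module on the farm; the one change is
that `finite_fibre` (local Weyl law) is replaced by `finite_level_of_isTrace` below (summability at
the peak test), so `LocalWeyl.lean` is still not imported. -/

section Reduction

/-- The right-hand side of the crux: multiplicity of `z` as a NON-TRIVIAL zero, in `ℕ∞`. [folklore] -/
def mult (z : ℂ) : ℕ∞ :=
  ZetaZeros.riemannZetaNontrivialZeros.indicator (fun w => (analyticOrderNatAt riemannZeta w : ℕ∞)) z

/-- The fibre of the family over `z`. [folklore] -/
def fibre {ι : Type*} (γ : ι → ℝ) (z : ℂ) : Set ι :=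
  {i : ι | (1 / 2 : ℂ) + (γ i : ℂ) * I = z}

/-- The crux, unfolded into the vocabulary above (definitional). [folklore] -/
theorem spectralIsHpSpectrum_iff :
    SpectralIsHpSpectrum ↔
      ∀ (ι : Type) (γ : ι → ℝ), (∀ g : ℝ → ℂ, IsWeilTest g →
      HasSum (fun i => weilMellin g (1 / 2 + (γ i : ℂ) * I)) (weilFunctional g)) → ∀ z : ℂ, (fibre γ z).encard = mult z :=
  Iff.rfl

/-! ## §1 Why no unconditional kill exists: the hypothesis proves RH -/

/-- A full trace is a window trace on every window. [folklore] -/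
theorem windowTrace_of_isTrace {ι : Type*} {γ : ι → ℝ} (h : (∀ g : ℝ → ℂ, IsWeilTest g →
      HasSum (fun i => weilMellin g (1 / 2 + (γ i : ℂ) * I)) (weilFunctional g))) (A : ℝ) :
    ∀ g : ℝ → ℂ, IsWeilTest g → tsupport g ⊆ Icc (-A) A →
      HasSum (fun i => weilMellin g (1 / 2 + (γ i : ℂ) * I)) (weilFunctional g) :=
  fun g hg _ => h g hg

/-- A compactly supported function is supported in some `[-R, R]`, `R > 0`. [folklore] -/
theorem exists_tsupport_subset_Icc {g : ℝ → ℂ} (hg : HasCompactSupport g) :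
    ∃ R : ℝ, 0 < R ∧ tsupport g ⊆ Icc (-R) R := by
  obtain ⟨R, hR⟩ := hg.isCompact.isBounded.subset_closedBall 0
  refine ⟨max R 1, by positivity, hR.trans fun x hx => ?_⟩
  rw [Metric.mem_closedBall, dist_zero_right, Real.norm_eq_abs] at hx
  have h1 := le_max_left R 1
  exact ⟨by linarith [neg_abs_le x], by linarith [le_abs_self x]⟩

/-- **Bochner form of a full trace**: `HasSum (i ↦ |ĝ(1/2+iγ_i)|²) (Re Q(g))` for every Weil test
(`hasSum_norm_sq_of_windowTrace` on a window containing `supp (g ⋆ g̃)`). [folklore] -/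
theorem hasSum_norm_sq_of_isTrace {ι : Type*} {γ : ι → ℝ} (h : (∀ g : ℝ → ℂ, IsWeilTest g →
      HasSum (fun i => weilMellin g (1 / 2 + (γ i : ℂ) * I)) (weilFunctional g))) {g : ℝ → ℂ}
    (hg : IsWeilTest g) :
    HasSum (fun i => ‖weilMellin g (1 / 2 + (γ i : ℂ) * I)‖ ^ 2) (weilQuadratic g).re := by
  obtain ⟨R, -, hR⟩ := exists_tsupport_subset_Icc hg.2
  refine hasSum_norm_sq_of_windowTrace (A := 2 * R) (windowTrace_of_isTrace h (2 * R)) hg ?_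
  rwa [show (2 * R) / 2 = R by ring]

/-- **Any family satisfying the hypothesis of the crux proves RH** (Weil's criterion,
`weil_criterion_holds`). [folklore] -/
theorem riemannHypothesis_of_isTrace {ι : Type*} {γ : ι → ℝ} (h : (∀ g : ℝ → ℂ, IsWeilTest g →
      HasSum (fun i => weilMellin g (1 / 2 + (γ i : ℂ) * I)) (weilFunctional g))) :
    _root_.RiemannHypothesis :=
  (show _root_.RiemannHypothesis ↔ WeilPositivity from weil_criterion_holds).2
    fun _ hg => (hasSum_norm_sq_of_isTrace h hg).nonneg fun _ => by positivity

/-! ## §2 The reduction handed to the prover -/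

/-- Membership in a fibre: `z` must be on the critical line and `γ_i = Im z`. [folklore] -/
theorem mem_fibre_iff {ι : Type*} (γ : ι → ℝ) (z : ℂ) (i : ι) :
    i ∈ fibre γ z ↔ z.re = 1 / 2 ∧ γ i = z.im := by
  simp only [fibre, mem_setOf_eq]
  constructor
  · rintro rfl
    simp
  · rintro ⟨hre, him⟩
    apply Complex.ext <;> simp [hre, him]

/-- Off the critical line every fibre is empty. [folklore] -/
theorem fibre_eq_empty_of_re_ne {ι : Type*} (γ : ι → ℝ) {z : ℂ} (hz : z.re ≠ 1 / 2) :
    fibre γ z = ∅ := by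
  ext i
  simp only [mem_fibre_iff, mem_empty_iff_false, iff_false, not_and]
  exact fun h _ => hz h

/-- On the critical line the fibre over `1/2 + iτ` is `{i | γ_i = τ}`. [folklore] -/
theorem fibre_half_add {ι : Type*} (γ : ι → ℝ) (τ : ℝ) :
    fibre γ (1 / 2 + τ * I) = {i | γ i = τ} := by
  ext i
  simp [mem_fibre_iff]

/-- The analytic order of `ζ` is finite away from the pole (identity principle, `ζ(2) ≠ 0`).
[folklore] -/
theorem analyticOrderAt_riemannZeta_ne_top' {ρ : ℂ} (h : ρ ≠ 1) :
    analyticOrderAt riemannZeta ρ ≠ ⊤ := by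
  intro htop
  have h2 : riemannZeta 2 = 0 :=
    analyticOn_riemannZeta.eqOn_zero_of_preconnected_of_eventuallyEq_zero
      (isConnected_compl_singleton_of_one_lt_rank (by simp) (1 : ℂ)).isPreconnected h
      (analyticOrderAt_eq_top.mp htop) (show (2 : ℂ) ∈ ({1}ᶜ : Set ℂ) by norm_num)
  exact riemannZeta_ne_zero_of_one_le_re (s := 2) (by norm_num) h2

/-- `mult z = 0` off the non-trivial zeros. [folklore] -/
theorem mult_of_not_mem {z : ℂ} (hz : z ∉ ZetaZeros.riemannZetaNontrivialZeros) : mult z = 0 :=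
  Set.indicator_of_notMem hz _

/-- At a non-trivial zero, `mult z` is the analytic order of `ζ`. [folklore] -/
theorem mult_of_mem {z : ℂ} (hz : z ∈ ZetaZeros.riemannZetaNontrivialZeros) :
    mult z = analyticOrderAt riemannZeta z := by
  rw [mult, Set.indicator_of_mem hz, Nat.cast_analyticOrderNatAt
    (analyticOrderAt_riemannZeta_ne_top' (ZetaZeros.riemannZetaNontrivialZeros.ne_one hz))]

/-- Under RH the non-trivial zeros are on the critical line (unfolding Mathlib's clauses).
[folklore] -/
theorem re_eq_half_of_mem (hRH : _root_.RiemannHypothesis) {z : ℂ}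
    (hz : z ∈ ZetaZeros.riemannZetaNontrivialZeros) : z.re = 1 / 2 := by
  refine hRH z (ZetaZeros.riemannZetaNontrivialZeros.zeta_eq_zero hz) ?_
    (ZetaZeros.riemannZetaNontrivialZeros.ne_one hz)
  rintro ⟨n, hn⟩
  have h0 := ZetaZeros.riemannZetaNontrivialZeros.re_pos hz
  rw [hn] at h0
  simp at h0
  linarith [n.cast_nonneg (α := ℝ)]

/-- **Off the critical line both sides of the crux vanish** for a trace family (the fibre is
empty; the hypothesis gives RH, which empties the right-hand side). [folklore] -/
theorem encard_fibre_eq_mult_of_re_ne_half {ι : Type*} {γ : ι → ℝ} (h : (∀ g : ℝ → ℂ, IsWeilTest g →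
      HasSum (fun i => weilMellin g (1 / 2 + (γ i : ℂ) * I)) (weilFunctional g))) {z : ℂ}
    (hz : z.re ≠ 1 / 2) : (fibre γ z).encard = mult z := by
  rw [fibre_eq_empty_of_re_ne γ hz, Set.encard_empty,
    mult_of_not_mem fun hmem => hz (re_eq_half_of_mem (riemannHypothesis_of_isTrace h) hmem)]

/-- In the open strip, `mult s` IS the analytic order — no case split on `ζ s = 0` survives.
[folklore] -/
theorem mult_eq_analyticOrderAt_of_mem_strip {s : ℂ} (h0 : 0 < s.re) (h1 : s.re < 1) :
    mult s = analyticOrderAt riemannZeta s := by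
  by_cases hζ : riemannZeta s = 0
  · exact mult_of_mem (ZetaZeros.riemannZetaNontrivialZeros.mem_of_re_pos hζ h0)
  · rw [mult_of_not_mem fun h => hζ (ZetaZeros.riemannZetaNontrivialZeros.zeta_eq_zero h)]
    have hs : s ≠ 1 := by
      intro h; rw [h] at h1; simp at h1
    exact ((analyticOn_riemannZeta s hs).analyticOrderAt_eq_zero.2 hζ).symm

/-- `m(s) = analyticOrderNatAt ζ s` for every `s ≠ 1`: the explicit formula's multiplicity is the
crux's multiplicity. [folklore] -/
theorem riemannZetaZeroOrder_eq_analyticOrderNatAt {s : ℂ} (hs : s ≠ 1) :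
    riemannZetaZeroOrder s = (analyticOrderNatAt riemannZeta s : ℤ) := by
  have ha : AnalyticAt ℂ riemannZeta s := analyticOn_riemannZeta s hs
  obtain ⟨n, hn⟩ := ENat.ne_top_iff_exists.mp (analyticOrderAt_riemannZeta_ne_top' hs)
  rw [riemannZetaZeroOrder, ha.meromorphicOrderAt_eq, ← hn, ENat.map_coe, WithTop.untop₀_coe,
    analyticOrderNatAt, ← hn, ENat.toNat_coe]

/-- A point `1/2 + iτ` of the critical line is not the pole. [folklore] -/
theorem half_add_ne_one (τ : ℝ) : (1 / 2 : ℂ) + τ * I ≠ 1 := by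
  intro h
  have := congrArg Complex.re h
  norm_num at this

/-- **On the critical line the crux's equation is `#{i | γ_i = τ} = m(1/2+iτ)` in `ℤ`**, for any
family with finite fibres. [folklore] -/
theorem encard_fibre_eq_mult_iff {ι : Type*} (γ : ι → ℝ) (τ : ℝ) (hfin : {i | γ i = τ}.Finite) :
    (fibre γ (1 / 2 + τ * I)).encard = mult (1 / 2 + τ * I) ↔
      (({i : ι | γ i = τ}.ncard : ℕ) : ℤ) = riemannZetaZeroOrder (1 / 2 + τ * I) := by
  have hs : (1 / 2 : ℂ) + τ * I ≠ 1 := half_add_ne_one τ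
  obtain ⟨n, hn⟩ := ENat.ne_top_iff_exists.mp (analyticOrderAt_riemannZeta_ne_top' hs)
  have hnat : analyticOrderNatAt riemannZeta (1 / 2 + τ * I) = n := by
    rw [analyticOrderNatAt, ← hn, ENat.toNat_coe]
  rw [fibre_half_add, mult_eq_analyticOrderAt_of_mem_strip (by simp) (by norm_num),
    riemannZetaZeroOrder_eq_analyticOrderNatAt hs, hnat, ← hn, ← hfin.cast_ncard_eq, Nat.cast_inj,
    Nat.cast_inj]

end Reduction

/-- Every level set `{i | γ i = τ}` of a trace family is finite — from SUMMABILITY at the peak test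
(no local Weyl law): `a(γ_i) = 1` on the level set and `Σ_i a(γ_i) < ∞`. -/
theorem finite_level_of_isTrace {ι : Type*} {γ : ι → ℝ} (hγ : (∀ g : ℝ → ℂ, IsWeilTest g →
      HasSum (fun i => weilMellin g (1 / 2 + (γ i : ℂ) * I)) (weilFunctional g))) (τ : ℝ) :
    {i | γ i = τ}.Finite := by
  obtain ⟨k, hk, a, hka, h0, h1, hpeak⟩ := exists_peak_test τ
  have h := hγ _ (isWeilTest_convPow hk 0).1
  have h' : HasSum (fun i => (((a (γ i) ^ (0 + 1) : ℝ)) : ℂ)) (weilFunctional (convPow k 0)) := by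
    convert h using 1
    ext i
    rw [(isWeilTest_convPow hk 0).2, hka, Complex.ofReal_pow]
  have hreal : HasSum (fun i => a (γ i) ^ (0 + 1)) (weilFunctional (convPow k 0)).re := by
    simpa only [Complex.reCLM_apply, Complex.ofReal_re] using h'.mapL Complex.reCLM
  have hsum : Summable (fun i => a (γ i)) := by simpa using hreal.summable
  have hev := hsum.tendsto_cofinite_zero.eventually (gt_mem_nhds (show (0 : ℝ) < 1 / 2 by norm_num))
  have hfin : {i | ¬ (a (γ i) < 1 / 2)}.Finite := Filter.eventually_cofinite.1 hev
  refine hfin.subset fun i hi => ?_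
  simp only [Set.mem_setOf_eq] at hi ⊢
  rw [(hpeak (γ i)).2 hi]
  norm_num

/-- **THE CRUX, PROVED.** `SpectralIsHpSpectrum` (stmt-RiemannHypothesis-0195) with no hypotheses:
RH from the hypothesis (§1), off-line bookkeeping (§2), and on the line the power-method count
`ordinate_count_of_isTrace`. -/
theorem spectralIsHpSpectrum_proved : SpectralIsHpSpectrum := by
  rw [spectralIsHpSpectrum_iff]
  intro ι γ hγ z
  have hRH := riemannHypothesis_of_isTrace hγ
  by_cases hz : z.re = 1 / 2
  · have hzeq : z = 1 / 2 + (z.im : ℝ) * I := by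
      apply Complex.ext <;> simp [hz]
    have hfin : {i | γ i = z.im}.Finite := finite_level_of_isTrace hγ z.im
    rw [hzeq]
    exact (encard_fibre_eq_mult_iff γ z.im hfin).2 (ordinate_count_of_isTrace ι γ hRH hγ z.im)
  · exact encard_fibre_eq_mult_of_re_ne_half hγ hz

end Summit.RiemannHypothesis.RiemannHypothesis.Cruxes.SpectralIsHpSpectrum.PowerMethod

end
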